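import Summits.ResolutionOfSingularities.ResolutionOfSingularities.Theorems.HeronCutLaw2
import Summits.ResolutionOfSingularities.ResolutionOfSingularities.Theorems.ThreadCutPinf
import HarnessLib

/-!
# HeronCutStar — decomp-res node «HeronCut» (lens-5 g32, critic row 201 CLEARED (T-3) +1), tree file 3/3 of the node

Content VERBATIM from the decomp-res lens-5 g32 node «HeronCut», landing shape (A′)
`HOME/decomp-res-lens-5/g32/landing/HeronCutLaw.lean` (ea49c374) / (B′) `landing/HeronCutStar.lean` (0944ef8c) (shas
= PIN STATUS 08:54:16Z; carry replaced by the landed `ThreadCutLaw*` / `ThreadCutPinf`); HOME =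
run/shared/lean/pub/decomp-res; critic CRITIC-LEDGER row 201 CLEARED (T-3) +1; landing orders INBOX :1252
(08:57:52Z) — provenance and critic text in full in the first file of the node, `HeronCutLaw`; the (A′) landing
header verbatim in `HeronCutLaw2`.  `--kind proof --supports stmt-ResolutionOfSingularities-31770`.

The (B′) landing header, verbatim:

> # HeronCutStar — EXACTNESS of the all-chart thread law: TRISTAR stages carry every ternary corner word; the certified
> star roots `(s·u·w)^a`; the in-Lean period-3 desk (lens-5 g32 «HeronCut» §5–§7; LANDING SHAPE (B′) of
> `HOME/decomp-res-lens-5/g32/HeronCut.lean`, imports (A′) `HeronCutLaw` and the rider-198 file `ThreadCutPinf` (§5 cruciform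
> existence of g31)).  0 `sorry`.  (Sources: Hauser2010 §§F–G; ThreadCut (lens-5 g31).)

## This file

(B′) §5 EXACTNESS (`section Tristar`): `Tristar q F` (↔ ∀ J K, `Cruciform q J K F`), **`Thread.ofTristar`** — a
tristar stage carries the infinite corner thread of EVERY word `ω : ℕ → Fin 3`, tristar and non-isolated at every
stage; §6 THE CERTIFIED STAR ROOTS (`section Star`): `starF a = (X_s·X_u·X_w)^a`, `star_isRoot` (`q ≤ 2a`, `q ∤ a`),
`starThread`, the inhabitant `z³ + s²u²w²` (`star32_isRoot`, `star32_cyclic_recurs` — the cyclic word recurs in all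
three charts; a THREAD, not a forced walk); §7 THE IN-LEAN DESK (`section Desk`): the period-3 word on the monomial
families by `decide` (`runWord`, `cyc3`).

[WRITER NOTE (decomp-res writer g13): file split only — (A′) is 547 lines, over the tree's 400-line cap, and is cut
at the node's own root-namespace boundary: `HeronCutLaw` = `namespace …Theorems.HeronCut` (§1–§2), `HeronCutLaw2` =
`namespace …Theorems.ThreadCut` (§3–§4); (B′) `HeronCutStar` is one file; sections, section variables, `open … in`
combinators and every declaration exactly as in the landing files; the file-level `open` lines are replayed in each
part.  TWO writer token fixes, both forced: (i) the landing files' import lines spell the module prefix `Summit.…`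
(a typo — the tree's modules are `Summits.…`, as in the node file itself) → `Summits.…`; (ii) `ThreadCutLaw` was cut
by the cap into `ThreadCutLaw` + `ThreadCutLaw2` at its landing (g12), so (A′) imports `ThreadCutLaw2` (⊇
`ThreadCutLaw`) to have the whole of g31 §1–§4 in scope, and (B′) imports `HeronCutLaw2` (⊇ `HeronCutLaw`).]

(Sources: Hauser2010 §§F–G (kangaroo points, corner/translation moves); CossartJannsenSaito2020 Ch. 8;
HauserPerlega2019 §2; Hironaka1964 Ch. III.)
-/

open MvPolynomial
open Literature.AlgebraicGeometry.Resolution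
open Literature.AlgebraicGeometry.Resolution.Hauser2010
open Literature.AlgebraicGeometry.Resolution.PointBlowup
open Summit.ResolutionOfSingularities.ResolutionOfSingularities.Theorems.TightDefectClasses
open Summit.ResolutionOfSingularities.ResolutionOfSingularities.Theorems.CornerTowerDescent
open Summit.ResolutionOfSingularities.ResolutionOfSingularities.Theorems.LassoCut

namespace Summit.ResolutionOfSingularities.ResolutionOfSingularities.Theorems.ThreadCut

open Summit.ResolutionOfSingularities.ResolutionOfSingularities.Theorems.HeronCut

section Tristar

variable {K : Type} [Field K] [DecidableEq K] {q : ℕ}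

/-! ## §5 EXACTNESS: TRISTAR stages carry the FULL ternary tree of corner threads (the kind is inhabited for every word) -/

/-- A **TRISTAR** stage: all monomials of degree `≥ q` and off-heavy for EVERY chart (all three axes are top lines; the
absorbing orthant `ρ ≥ 0` of the Heron dynamics). DEFINITION (the normal form of the all-chart kind). -/
def Tristar (q : ℕ) (F : MvPolynomial (Fin 3) K) : Prop :=
  (∀ m ∈ F.support, q ≤ m.degree) ∧ ∀ k, OffHeavy q k F

omit [DecidableEq K] in
/-- tristar = cruciform for every pair of charts. [folklore] -/
theorem tristar_iff_cruciform {F : MvPolynomial (Fin 3) K} : Tristar q F ↔ ∀ J K' : Fin 3, Cruciform q J K' F :=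
  ⟨fun h J K' => ⟨h.1, h.2 J, h.2 K'⟩, fun h => ⟨(h 0 0).1, fun k => (h k k).2.1⟩⟩

/-- a corner step in ANY chart keeps a tristar stage tristar. [DECIDED — PROVED here] (Sources: Hauser2010, §F.) -/
theorem tristar_step {j : Fin 3} {s : State (Fin 3) K} (h : Tristar q s.F) : Tristar q (step q j 0 s).F :=
  ⟨(cruciform_step (J := j) (K' := j) (j := j) ⟨h.1, h.2 j, h.2 j⟩ (Or.inl rfl)).1,
    fun k => (cruciform_step (J := j) (K' := k) (j := j) ⟨h.1, h.2 j, h.2 k⟩ (Or.inl rfl)).2.2⟩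

/-- … along every corner word. [folklore] -/
theorem tristar_cornerStates {s₀ : State (Fin 3) K} (h₀ : Tristar q s₀.F) (ω : ℕ → Fin 3) :
    ∀ t, Tristar q (cornerStates q ω s₀ t).F
  | 0 => h₀
  | t + 1 => tristar_step (tristar_cornerStates h₀ ω t)

/-- the origin of EVERY chart of a tristar stage is an equimultiple point. [folklore] -/
theorem isEquimultiplePoint_of_tristar {j : Fin 3} {s : State (Fin 3) K} (h : Tristar q s.F) :
    IsEquimultiplePoint q j 0 s :=
  isEquimultiplePoint_of_cruciform (J := j) (K' := j) ⟨h.1, h.2 j, h.2 j⟩ (Or.inl rfl)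

/-- **EXISTENCE HALF OF THE ALL-CHART LAW**: a tristar stage carries, for EVERY word `ω : ℕ → Fin 3` (all `3^ℕ` of
them, no restriction), the infinite corner thread playing `ω` with all points `b = 0`.  With §3: corner threads live
EXACTLY over eventually-axial stages, tristar ones when all charts recur — the kind «all corner threads» is decided
iff-wise, and inhabited. [DECIDED — PROVED here] (Sources: Hauser2010, §F.) -/
noncomputable def Thread.ofTristar (s₀ : State (Fin 3) K) (h₀ : Tristar q s₀.F) (ω : ℕ → Fin 3) : Thread q s₀ where
  j := ω
  b := fun _ => 0
  st := cornerStates q ω s₀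
  st_zero := rfl
  st_succ := fun _ => rfl
  onExc := fun _ => rfl
  equimult := fun t => isEquimultiplePoint_of_tristar (tristar_cornerStates h₀ ω t)

/-- bookkeeping. [folklore] -/
@[simp] theorem Thread.ofTristar_j (s₀ : State (Fin 3) K) (h₀ : Tristar q s₀.F) (ω : ℕ → Fin 3) (t : ℕ) :
    (Thread.ofTristar s₀ h₀ ω).j t = ω t := rfl

/-- bookkeeping. [folklore] -/
@[simp] theorem Thread.ofTristar_b (s₀ : State (Fin 3) K) (h₀ : Tristar q s₀.F) (ω : ℕ → Fin 3) (t : ℕ) :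
    (Thread.ofTristar s₀ h₀ ω).b t = 0 := rfl

/-- every tristar thread is a CORNER TAIL from `t = 0`. [folklore] -/
theorem Thread.ofTristar_cornerTail (s₀ : State (Fin 3) K) (h₀ : Tristar q s₀.F) (ω : ℕ → Fin 3) :
    (Thread.ofTristar s₀ h₀ ω).CornerTailFrom 0 := fun _ _ => rfl

/-- distinct words give distinct threads (`3^ℕ` threads). [folklore] -/
theorem Thread.ofTristar_injective (s₀ : State (Fin 3) K) (h₀ : Tristar q s₀.F) :
    Function.Injective (Thread.ofTristar s₀ h₀) := fun ω ω' h => by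
  have := congrArg Thread.j h
  exact this

/-- The threads of a tristar stage are TRISTAR AT EVERY STAGE, hence have NON-ISOLATED top points at every stage, the
three top axes meeting there. [DECIDED — PROVED here] (Sources: Hauser2010, §F.) -/
theorem Thread.ofTristar_not_isolated (s₀ : State (Fin 3) K) (h₀ : Tristar q s₀.F) (ω : ℕ → Fin 3) (t : ℕ) :
    Tristar q ((Thread.ofTristar s₀ h₀ ω).st t).F ∧ ¬ IsolatedTop q ((Thread.ofTristar s₀ h₀ ω).st t).F ∧
      topIdeal q ((Thread.ofTristar s₀ h₀ ω).st t).F ≤ ⨅ k : Fin 3, Ideal.span (MvPolynomial.X '' {i : Fin 3 | i ≠ k}) := by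
  have h := tristar_cornerStates h₀ ω t
  exact ⟨h, not_isolatedTop_of_offHeavy (h.2 0), topIdeal_le_tripod h.2⟩

/-- … and a tristar stage carries NO forced walk. [folklore] -/
theorem no_forcedWalk_of_tristar {s₀ : State (Fin 3) K} (h₀ : Tristar q s₀.F) (W : ForcedWalk q s₀) : False :=
  no_forcedWalk_of_cruciform (J := 0) (K' := 0) ⟨h₀.1, h₀.2 0, h₀.2 0⟩ W

end Tristar

section Star

variable (K : Type) [Field K] [DecidableEq K]

/-! ## §6 THE TRISTAR CERTIFICATE: the root `(s·u·w)^a`, `q ≤ 2a`, `q ∤ a` (e.g. `z³ + s²u²w²`) -/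

/-- the exponent `(a,a,a)` of `(s·u·w)^a`. DEFINITION (support). -/
noncomputable def starExp (a : ℕ) : Fin 3 →₀ ℕ := Finsupp.single 0 a + Finsupp.single 1 a + Finsupp.single 2 a

/-- the STAR polynomial `(s·u·w)^a`. DEFINITION (support). -/
noncomputable def starF (a : ℕ) : MvPolynomial (Fin 3) K := monomial (starExp a) 1

/-- the STAR ROOT STATE `⟨(s·u·w)^a, r = 0⟩`. DEFINITION (support). -/
noncomputable def starRoot (a : ℕ) : State (Fin 3) K := ⟨starF K a, 0⟩

omit [DecidableEq K] in
/-- dictionary: `starF a = (X_s · X_u · X_w)^a`. [folklore] -/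
theorem starF_eq (a : ℕ) : starF K a = (X 0 * X 1 * X 2) ^ a := by
  unfold starF starExp
  rw [MvPolynomial.X, MvPolynomial.X, MvPolynomial.X, monomial_mul, monomial_mul, monomial_pow]
  simp

variable {K}

/-- arithmetic of `(a,a,a)`. [folklore] -/
theorem starExp_apply (a : ℕ) (k : Fin 3) : starExp a k = a := by
  fin_cases k <;> simp [starExp]

/-- arithmetic of `(a,a,a)`. [folklore] -/
theorem starExp_degree (a : ℕ) : (starExp a).degree = 3 * a := by
  simp [starExp, map_add, Finsupp.degree_single]; ring

variable (K)

omit [DecidableEq K] in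
/-- the support of the star polynomial is the single exponent `(a,a,a)`. [folklore] -/
theorem support_starF (a : ℕ) : (starF K a).support = {starExp a} := by
  classical
  unfold starF
  rw [support_monomial, if_neg one_ne_zero]

omit [DecidableEq K] in
/-- **THE STAR IS TRISTAR** as soon as `q ≤ 2a` (every off-degree is `2a`). [DECIDED — PROVED here] [folklore] -/
theorem star_tristar {q a : ℕ} (hq : q ≤ 2 * a) : Tristar q (starF K a) := by
  refine ⟨fun m hm => ?_, fun k m hm => ?_⟩ <;>
    rw [support_starF, Finset.mem_singleton] at hm <;> subst hm
  · rw [starExp_degree]; omega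
  · rw [starExp_degree, starExp_apply]; omega

omit [DecidableEq K] in
/-- `(a,a,a)` is no `q`-th power exponent when `q ∤ a`: the star state is CLEAN. [folklore] -/
theorem starExp_not_isPthPowerExponent {q a : ℕ} (ha : ¬ q ∣ a) : ¬ IsPthPowerExponent q (starExp a) := by
  rw [isPthPowerExponent_iff]
  intro h
  have := h 0
  rw [starExp_apply] at this
  exact ha this

omit [DecidableEq K] in
/-- **THE STAR STATE IS A ROOT of lens-5's model** (`IsRoot q`: `r = 0`, clean, `ord₀ = 3a ≥ q`) whenever `q ≤ 2a`,
`q ∤ a`. [DECIDED — PROVED here] [folklore] -/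
theorem star_isRoot {q a : ℕ} (hq : q ≤ 2 * a) (ha : ¬ q ∣ a) : IsRoot q (starRoot K a) := by
  classical
  refine ⟨rfl, ?_, ?_⟩
  · change deletePthPowers q (starF K a) = starF K a
    unfold starF
    rw [deletePthPowers_monomial, if_neg (starExp_not_isPthPowerExponent ha)]
  · change ((q : ℕ) : ℕ∞) ≤ ordZero (starF K a)
    unfold ordZero
    refine MvPowerSeries.nat_le_order fun d hd => ?_
    rw [MvPolynomial.coeff_coe]
    unfold starF
    rw [coeff_monomial, if_neg]
    rintro rfl
    rw [starExp_degree] at hd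
    have hd' : 3 * a < q := by exact_mod_cast hd
    omega

/-- **THE STAR'S THREADS**: for EVERY word `ω : ℕ → Fin 3` the infinite corner thread playing `ω` from the star root —
`3^ℕ` corner tails using (for suitable `ω`) ALL THREE charts infinitely often, each tristar and NON-ISOLATED at every
stage; and the star root carries NO forced walk.  The certified inhabitant of the kind «all corner threads» IN THE
LOCATED RESIDUAL (a root of the E-model: `star_isRoot`). [DECIDED — PROVED here] -/
noncomputable def starThread {q : ℕ} (a : ℕ) (hq : q ≤ 2 * a) (ω : ℕ → Fin 3) : Thread q (starRoot K a) :=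
  Thread.ofTristar (starRoot K a) (star_tristar K hq) ω

/-- every star thread is a corner tail from `0` … [DECIDED — PROVED here] [folklore] -/
theorem starThread_cornerTail {q : ℕ} (a : ℕ) (hq : q ≤ 2 * a) (ω : ℕ → Fin 3) :
    (starThread K a hq ω).CornerTailFrom 0 :=
  Thread.ofTristar_cornerTail _ _ ω

/-- … playing exactly the word `ω` (so the cyclic word uses all three charts infinitely often) … [folklore] -/
theorem starThread_j {q : ℕ} (a : ℕ) (hq : q ≤ 2 * a) (ω : ℕ → Fin 3) (t : ℕ) : (starThread K a hq ω).j t = ω t := rfl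

/-- … with a NON-ISOLATED, TRISTAR top point at every stage … [DECIDED — PROVED here] [folklore] -/
theorem starThread_not_isolated {q : ℕ} (a : ℕ) (hq : q ≤ 2 * a) (ω : ℕ → Fin 3) (t : ℕ) :
    ¬ IsolatedTop q ((starThread K a hq ω).st t).F :=
  (Thread.ofTristar_not_isolated _ _ ω t).2.1

/-- … and NO forced walk starts at the star root. [DECIDED — PROVED here] [folklore] -/
theorem star_no_forcedWalk {q : ℕ} (a : ℕ) (hq : q ≤ 2 * a) (W : ForcedWalk q (starRoot K a)) : False :=
  no_forcedWalk_of_tristar (star_tristar K hq) W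

omit [DecidableEq K] in
/-- THE CONCRETE INSTANCE `z³ + s²u²w²` (`q = 3`, `a = 2`): a ROOT … [DECIDED — PROVED here] [folklore] -/
theorem star32_isRoot : IsRoot 3 (starRoot K 2) := star_isRoot K (by norm_num) (by norm_num)

/-- … carrying the corner thread of EVERY ternary word, e.g. the cyclic word `s u w s u w …`. [DECIDED — PROVED here] -/
noncomputable def star32Thread (ω : ℕ → Fin 3) : Thread 3 (starRoot K 2) := starThread K 2 (by norm_num) ω

/-- the CYCLIC word `s u w s u w …` (`t ↦ t mod 3`). DEFINITION (support). -/
def cyc3 : ℕ → Fin 3 := fun t => ⟨t % 3, Nat.mod_lt _ (by norm_num)⟩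

/-- the cyclic word uses every chart infinitely often along its star thread: a certified corner thread of a ROOT with
ALL THREE CHARTS RECURRING (the inhabitant of row 198's (T-3) kind). [DECIDED — PROVED here] [folklore] -/
theorem star32_cyclic_recurs (k : Fin 3) (N : ℕ) : ∃ t, N ≤ t ∧ (star32Thread K cyc3).j (t + 1) = k := by
  refine ⟨3 * N + 2 + k.val, by omega, ?_⟩
  change cyc3 (3 * N + 2 + k.val + 1) = k
  rw [Fin.ext_iff]
  change (3 * N + 2 + k.val + 1) % 3 = k.val
  have := k.isLt
  omega

end Star

section Desk

/-! ## §7 IN-LEAN DESK (0-priced): the Heron arithmetic of the period-3 word on the two monomial families of the run -/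

/-- P∞'s monomial `s·u²·w` at `q = 3`: defect `ρ = (0,−1,0)` is MIXED, `Ψ = −1`, light charge `1 − Ψ = 2`: at most two
light corner blow-ups in ANY word before the thread is axial or dead (g31: its `s/w`-threads have none; the `u`-step makes
it triply negative `(−1,−1,−1)`, `Ψ ↦ −1 + 4·1 = 3 > 0`, and the thread dies by degree descent). [folklore] -/
example : heron (![0, -1, 0] : Fin 3 → ℤ) = -1 ∧ heron (![-1, -1, -1] : Fin 3 → ℤ) = 3 := by
  constructor <;> simp [heron_fin_three]

/-- the STAR family `(s·u·w)^a` at exponent `q`: defect `ρ = (2a−q)·(1,1,1)` on the time axis of the Lorentz form,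
`Ψ = 3(2a−q)² ≥ 0` — the absorbing orthant iff `q ≤ 2a` (§6), e.g. `a = 2`, `q = 3`: `Ψ(1,1,1) = 3`. [folklore] -/
example : heron (![1, 1, 1] : Fin 3 → ℤ) = 3 := by simp [heron_fin_three]

/-- the light monomial `s·u·w⁵` of `q = 3` (`off = (6,6,2)`, `ρ = (3,3,−1)`, MIXED, `Ψ = −13`): every LIGHT blow-up
(chart `w`, `ρ_w = −1`) raises `Ψ` by `4ρ_w² = 4` — `−13 ↦ −9 ↦ −5 ↦ −1` along `w w w` — and a fourth would give
`Ψ = 3 > 0`, impossible for a mixed vector by (H2) (indeed `(−1,−1,−1)` is triply negative: the thread is dead); the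
heavy letters `s`, `u` (`ρ = 0` at `(0,0,−1)`) are neutral.  So AT MOST 3 light steps in ANY word; the period-3 word
`s u w …` is absorbed at once (`s ↦ (3,6,2) ≥ 0`). [folklore] -/
example : heron (![3, 3, -1] : Fin 3 → ℤ) = -13 ∧ heron (![2, 2, -1] : Fin 3 → ℤ) = -9 ∧
    heron (![1, 1, -1] : Fin 3 → ℤ) = -5 ∧ heron (![0, 0, -1] : Fin 3 → ℤ) = -1 ∧
    heron (![-1, -1, -1] : Fin 3 → ℤ) = 3 ∧ heron (![3, 6, 2] : Fin 3 → ℤ) = 23 := by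
  refine ⟨?_, ?_, ?_, ?_, ?_, ?_⟩ <;> simp [heron_fin_three]

/-- the corner TRANSVECTION of chart `j` on defect vectors (`ρ_j` fixed, `ρ_k ↦ ρ_k + ρ_j`): the exponent arithmetic
of one corner blow-up, decidable. DEFINITION (support; desk instrument). -/
def transvect (j : Fin 3) (ρ : Fin 3 → ℤ) : Fin 3 → ℤ := fun k => if k = j then ρ j else ρ k + ρ j

/-- the defect vectors along a corner WORD. DEFINITION (support; desk instrument). -/
def runWord (ω : ℕ → Fin 3) (ρ : Fin 3 → ℤ) : ℕ → Fin 3 → ℤ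
  | 0 => ρ
  | t + 1 => transvect (ω t) (runWord ω ρ t)

/-- PERIOD-3 DESK by `decide` (row 198: «desk the period-3 word on monomial families first, in-Lean»): under `s u w s u w …`
the light root monomial `s·u·w⁵` (`ρ = (3,3,−1)`) is ABSORBED after one step (`(3,6,2) ≥ 0`, heavy forever); P∞'s
`s·u²·w` (`ρ = (0,−1,0)`) DIES at the `u`-step (`(−1,−1,−1)`, triply negative); the star `(s·u·w)²` (`ρ = (1,1,1)`) stays
in the orthant (`(1,2,2)`, `(3,2,4)`, `(7,6,4)`): no perpetual light. [folklore] -/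
example : runWord cyc3 ![3, 3, -1] 1 = ![3, 6, 2] ∧ runWord cyc3 ![0, -1, 0] 2 = ![-1, -1, -1] ∧
    runWord cyc3 ![1, 1, 1] 3 = ![7, 6, 4] := by decide

end Desk

end Summit.ResolutionOfSingularities.ResolutionOfSingularities.Theorems.ThreadCut
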